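import Summits.MatrixMultiplication.MatrixMultiplication.Theses.FidelityWitnesses
import Summits.MatrixMultiplication.MatrixMultiplication.Theorems.FidelityWitnessesDiagonalPowerDecayStubPartialMMCapacity
import Literature.Computability.AlgebraicComplexity.PartialMatrixMultiplication

/-!
# Line `vertex-flattening-factor-rank` for crux `FidelityWitnesses.DiagonalPowerDecay` (stmt-MatrixMultiplication-14053)
# — lead c2's RESHAPED skeleton (2026-08-16)

THE CRUX. `DiagonalPowerDecay : ∃ C δ, 0 < δ ∧ ∀ n S, tensorRank S ≤ n² → |⟨S,T_n⟩|² ≤ C·n^{3−2δ}·‖S‖²`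
(`T_n = matMulTensor ℂ n n n`; `M(n,n²) ≤ C n^{3−2δ}`).

THE RESHAPE (planner's skeleton `Cruxes/DiagonalPowerDecay/Lines/vertex_flattening_factor_rank.lean`, § "What the line
says about the ROUTE", composition `dpd_of_exactnessSupp : RouteCollapse`, moved into TREE VOCABULARY where the literature
input is already PROVED). The planner cut the crux along EXACTNESS: an ω-free EXACTNESS PRINCIPLE (inexact L²-capture of
`⟨n,n,n⟩` by `n²` multiplications never beats EXACT sub-computation by a power of `n`) plus a CAPACITY bound for exact
sub-computations of rank `≤ n²`. With the comparison class taken to be Bürgisser–Clausen–Shokrollahi's partial matrix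
multiplications `⟨n,n,n⟩_{I,J}` (`Literature…partialMatMulTensor`, pattern `I, J ⊆ [n]×[n]`, `filling = #terms`), the capacity
bound is SCHÖNHAGE'S PARTIAL MATRIX MULTIPLICATION THEOREM (BCS Thm (15.48)), DISCHARGED in the tree
(`Schonhage1981_partialMatMul_holds`): `filling^{ω/3} ≤ R(⟨n,n,n⟩_{I,J})`, so rank `≤ n²` forces `filling ≤ n^{6/ω}` — sharper
than the planner's un-vendored `n^{9/(ω+1)}` (Vrana 2024 + Cohn–Umans 2013 for arbitrary term patterns) and unconditional.
What is left of the crux after the exactness cut is then LITERALLY `2 < ω(ℂ)`, which by the landed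
`two_lt_omega_of_fidelityThesis` / `omega_eq_two_of_not_fidelityThesis` (Theorems/FidelityThesis/Negative/SummitEquivalence.lean)
is the route TARGET `FidelityThesis` (⟺ ¬Summit) — named as a stub, not smuggled.

REGISTERED STUBS (3) and composition:
* `stub_exactnessIJ` (the line's ω-free content; OPEN; size XL; irrefutable short of `ω > 2`: `ω(ℂ) = 2 ⟹ stub` by box
  patterns, to be landed as a support `exactnessIJ_of_omega_eq_two`): `∀ ε>0 ∃ C>0 ∀ n≥1 ∀ S, R(S) ≤ n² →
  ∃ I J, R(⟨n,n,n⟩_{I,J}) ≤ n² ∧ |⟨S,T⟩|² ≤ C·n^ε·filling(I,J)·‖S‖²` — `M(n,n²) ≤ C_ε n^ε · max{f : some f-term partial MM has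
  rank ≤ n²}`.  At each fixed `n` it is trivial (`C = n³`: Cauchy–Schwarz + the 1-term pattern); the content is uniformity in `n`.
* `stub_partialMMCapacity` (CLOSED — landed p106973 by wave 1, `…Theorems.DiagonalPowerDecay.stub_partialMMCapacity`, from
  `Schonhage1981_partialMatMul_holds`): rank `≤ n²` partial matrix multiplications of the `n × n` format have filling `≤ n^{6/ω(ℂ)}`.
* `stub_twoLtOmega` (`2 < omega ℂ`; = FidelityThesis = ¬MatrixMultiplication by SummitEquivalence; the summit-hard residue,
  declared): blocked on the route target, item FidelityThesis.
* `DiagonalPowerDecay_of` — kernel-checked: `η := (3 − 6/ω)/2 > 0` (from stub 3), `C` from stub 1 at `ε := η`, `δ := η/2`;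
  for `n ≥ 1`: `|⟨S,T⟩|² ≤ C n^η · filling · ‖S‖² ≤ C n^η · n^{6/ω} · ‖S‖² = C n^{3−2(η/2)} ‖S‖²`; `n = 0`: empty sums.

WHAT THE RESHAPE BUYS (for the planner) — everything below is LANDED under Theorems/ (ns …Theorems.DiagonalPowerDecay):
* crux #5 = target #0 ∧ stub 1: `dpd_of_captureLaw_of_two_lt_omega`, `dpd_iff_fidelityThesis_of_captureLaw` (…ExactnessIJ.lean,
  p107930) with `DiagonalPowerDecay ⟹ FidelityThesis` the landed glue `diagonalPowerDecayGlue_proof`;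
* stub 1 is, parameter-free, the POINT LAW `∀ n S, R(S) ≤ n² → |⟨S,⟨n,n,n⟩⟩|² ≤ n^{6/ω(ℂ)}‖S‖²` ("M(n,n²) ≤ n^{6/ω}", an L²-robust
  Schönhage–Bini theorem at budget n²): `exactnessIJ_iff_captureLaw` (p107930), `exactnessIJ_iff_pointLaw`, `omega_le_of_pointLaw`
  (…PointLaw.lean); it holds if `ω(ℂ) = 2` (`exactnessIJ_of_omega_eq_two`, `_of_matrixMultiplication`, `_of_not_fidelityThesis`): the two open
  stubs cannot both fail, and stub 1 cannot be refuted without proving the target; `stub 1 ⟹ MatrixMultiplication ∨ DiagonalPowerDecay`;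
* the planner's original stubs: `stub_vertexRankLaw` LANDED (…StubVertexRankLaw.lean); `stub_projectorRankDecay` is NECESSARY
  (`projectorRankDecay_of_diagonalPowerDecay`) and SUMMIT-HARD (`two_lt_omega_of_projectorRankDecay`, `fidelityThesis_of_projectorRankDecay`)
  (…ProjectorRankDecay.lean, p108021); `stub_exactnessPrinciple` (projector form) is implied by `stub_exactnessIJ` ((I,J)-patterns are
  coordinate projectors).

Disproof lane honoured (`Cruxes/DiagonalPowerDecay/Disproof.lean`, cdisprove cycle 1 final): `false_without_rank` — the budget
`n²` enters stub 1 twice and stub 2 once (stub 2 is false without it: full pattern, filling `n³ > n^{6/ω}` iff `ω > 2`);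
`body_one_zero` — the `ε = 0, C = 1` exactness principle is FALSE at `n = 2` (`M(2,4) = 3+√2 > 4 = max filling at rank 4`),
hence `C n^ε`; every δ-cap (`delta_lt_three_sevenths`, `CertN4.delta_lt : δ < 41/106`) constrains the crux's `δ = η/2`, i.e.
`ω`, never the exactness ratio; `not_dpd_iff` — a kill of the crux is a FAMILY; under stub 1 it can be taken EXACT, i.e. it is
`ω = 2` made effective through partial matrix multiplication.  No `Negative/` lemma exists for this crux.
-/

noncomputable section

namespace Summit.MatrixMultiplication.MatrixMultiplication.Cruxes.DiagonalPowerDecay.VertexFlatteningFactorRank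

open scoped BigOperators
open Literature.Computability.AlgebraicComplexity
open Summit.MatrixMultiplication.MatrixMultiplication.Theses.FidelityWitnesses (DiagonalPowerDecay)

set_option linter.dupNamespace false

/-! ## The stubs (signatures over tree vocabulary only: `tensorRank`, `matMulTensor`, `partialMatMulTensor`, `filling`, `omega`) -/

/-- **Stub 1 — the EXACTNESS PRINCIPLE, (I,J)-pattern form (new; the line's ω-free content; size XL).**
For every `ε > 0` there is `C > 0` such that for all `n ≥ 1` and every `S` of tensor rank `≤ n²` some PARTIAL MATRIX
MULTIPLICATION `⟨n,n,n⟩_{I,J}` of rank `≤ n²` is nearly as good in fidelity: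
`|⟨S,T⟩|² ≤ C·n^ε·filling(I,J)·‖S‖²` (the fidelity `|⟨P,T⟩|²/‖P‖²` of `P = ⟨n,n,n⟩_{I,J}` is its filling).
Equivalently `M(n,n²) ≤ C_ε n^ε · F(n)`, `F(n) := max{filling(I,J) : R(⟨n,n,n⟩_{I,J}) ≤ n²}` (`F(n) ≥ n²`: the slice
`I = [n]×{0}`, `J = {0}×[n]`; `F(n) ≥ m³` whenever `R(⟨m,m,m⟩) ≤ n²`: boxes).  Trivial at each fixed `n` (`C = n³`); implied by
`ω(ℂ) = 2` (then `F(n) ≥ n^{3−o(1)}` by boxes — support `exactnessIJ_of_omega_eq_two`), hence irrefutable short of proving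
`ω > 2`; NOT implied by the crux; with Schönhage's theorem and `ω > 2` it GIVES the crux (`DiagonalPowerDecay_of`), so
`stub ⟹ (ω = 2 ∨ crux)`.  Why it might fail: an inexact rank-`n²` family beating every partial matrix multiplication by a power
of `n` (route Kill (vi); none known — every measured optimum `M(2,4) = 3+√2`, `M(3,9) → 11`, `M(4,16) → 22`, `M(5,25) → 33` is a
border-partial-MM packing, Disproof § NUMERICS). -/
theorem stub_exactnessIJ :
    ∀ ε : ℝ, 0 < ε → ∃ C : ℝ, 0 < C ∧ ∀ n : ℕ, 1 ≤ n →
      ∀ S : (Fin n × Fin n) → (Fin n × Fin n) → (Fin n × Fin n) → ℂ, tensorRank S ≤ n ^ 2 →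
        ∃ I J : Finset (Fin n × Fin n),
          tensorRank (partialMatMulTensor ℂ n n n I J) ≤ n ^ 2 ∧
          ‖∑ a, ∑ b, ∑ c, S a b c * matMulTensor ℂ n n n a b c‖ ^ 2 ≤
            C * (n : ℝ) ^ ε * (filling n n n I J : ℝ) * ∑ a, ∑ b, ∑ c, ‖S a b c‖ ^ 2 := by
  sorry

/-- **Stub 2 — CAPACITY of rank-`≤ n²` partial matrix multiplications (Schönhage 1981 / BCS Thm (15.48); provable now, size S).**
If `R(⟨n,n,n⟩_{I,J}) ≤ n²` then `filling(I,J) ≤ n^{6/ω(ℂ)}`: from the tree theorem `Schonhage1981_partialMatMul_holds`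
(`filling^{ω/3} ≤ bR ≤ R ≤ n²`) by raising to the power `3/ω` (`ω ≥ 2 > 0`, `omega_two_le`). `n = 0`: both sides are `0`
(`Fin 0` is empty, `0^{6/ω} = 0`). -/
theorem stub_partialMMCapacity :
    ∀ n : ℕ, ∀ I J : Finset (Fin n × Fin n),
      tensorRank (partialMatMulTensor ℂ n n n I J) ≤ n ^ 2 →
        (filling n n n I J : ℝ) ≤ (n : ℝ) ^ (6 / omega ℂ) :=
  -- LANDED (wave 1, p106973): Theorems/FidelityWitnessesDiagonalPowerDecayStubPartialMMCapacity.lean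
  Summit.MatrixMultiplication.MatrixMultiplication.Theorems.DiagonalPowerDecay.stub_partialMMCapacity

/-- **Stub 3 — `ω(ℂ) > 2` (the summit-hard residue, declared).** Equivalent to the route target `FidelityThesis`
(`two_lt_omega_of_fidelityThesis`, `omega_eq_two_of_not_fidelityThesis`, Theorems/FidelityThesis/Negative/SummitEquivalence.lean)
and to `¬MatrixMultiplication` (`MatrixMultiplication_iff : … ↔ omega ℂ = 2`, `omega_two_le`). Implied by the crux
(Disproof `two_lt_omega_of_dpd`; landed glue `diagonalPowerDecayGlue_proof`). Blocked on the target item; no tool. -/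
theorem stub_twoLtOmega : 2 < omega ℂ := by
  sorry

/-! ## The composition (kernel-checked, no `sorry` of its own) -/

/-- **`DiagonalPowerDecay` from the three stubs.** With `η := (3 − 6/ω)/2 > 0` (stub 3 and `ω > 0`), `C` from stub 1 at
`ε := η` and `δ := η/2`: for `n ≥ 1` and `S` of rank `≤ n²` pick the pattern `(I,J)` of stub 1; stub 2 bounds its filling by
`n^{6/ω}`; `n^η · n^{6/ω} = n^{3 − 2(η/2)}`. For `n = 0` every sum is empty. -/
theorem DiagonalPowerDecay_of : DiagonalPowerDecay := by
  have hE := stub_exactnessIJ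
  have hP := stub_partialMMCapacity
  have hω := stub_twoLtOmega
  have hωpos : 0 < omega ℂ := by linarith
  have hlt : 6 / omega ℂ < 3 := by
    rw [div_lt_iff₀ hωpos]; linarith
  set η : ℝ := (3 - 6 / omega ℂ) / 2 with hη
  have hη0 : 0 < η := by rw [hη]; linarith
  obtain ⟨C, hC, hEC⟩ := hE η hη0
  refine ⟨C, η / 2, by linarith, ?_⟩
  intro n S hS
  rcases Nat.eq_zero_or_pos n with rfl | hn
  · -- `n = 0`: the index type `Fin 0 × Fin 0` is empty, both sides vanish
    simp
  · obtain ⟨I, J, hIJ, hcmp⟩ := hEC n hn S hS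
    have hcap := hP n I J hIJ
    have hn0 : (0 : ℝ) < n := by exact_mod_cast hn
    have hexp : (n : ℝ) ^ η * (n : ℝ) ^ (6 / omega ℂ) = (n : ℝ) ^ (3 - 2 * (η / 2)) := by
      rw [← Real.rpow_add hn0]
      congr 1
      rw [hη]; ring
    calc ‖∑ a, ∑ b, ∑ c, S a b c * matMulTensor ℂ n n n a b c‖ ^ 2
        ≤ C * (n : ℝ) ^ η * (filling n n n I J : ℝ) * ∑ a, ∑ b, ∑ c, ‖S a b c‖ ^ 2 := hcmp
      _ ≤ C * (n : ℝ) ^ η * (n : ℝ) ^ (6 / omega ℂ) * ∑ a, ∑ b, ∑ c, ‖S a b c‖ ^ 2 := by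
            gcongr
      _ = C * ((n : ℝ) ^ η * (n : ℝ) ^ (6 / omega ℂ)) * ∑ a, ∑ b, ∑ c, ‖S a b c‖ ^ 2 := by ring
      _ = C * (n : ℝ) ^ (3 - 2 * (η / 2)) * ∑ a, ∑ b, ∑ c, ‖S a b c‖ ^ 2 := by rw [hexp]

end Summit.MatrixMultiplication.MatrixMultiplication.Cruxes.DiagonalPowerDecay.VertexFlatteningFactorRank

end
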